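import Summits.BirchSwinnertonDyer.BirchSwinnertonDyer.Theorems.CMKolyvaginAtInertTwoShaCountPairDefectAtTwo
import Summits.BirchSwinnertonDyer.BirchSwinnertonDyer.Theorems.CMKolyvaginAtInertTwoShaCountOfFactsAtTwo
import HarnessLib

/-!
# Route `CMKolyvaginAtInertTwo`, crux `CMKolyvaginExactAtInertTwo` (stmt-BirchSwinnertonDyer-24277):
# THE COUNT IDENTITY, XVIII — the two REGISTERED HALVES of the crux (`stub_upper`: `#Ш(E_K)[2^∞] ≤ 2^{2M₀}`,
# `stub_lower`: `2^{2M₀} ≤ #Ш(E_K)[2^∞]`) REDUCED to the corresponding halves for the PAIR `(E, E^{(d_K)})` over `ℚ`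

Seat `bsd-line-cmk2-p1` g16 (cell `bsd-print-cf2`); helper (`--supports stmt-BirchSwinnertonDyer-24277`).
THEOREMS ONLY: no definition, no named fact, no `sorry`; the route's published inputs (Gross–Zagier
all levels, GZK, modularity, Milne any-model — items 24148/19921/19273/24149) are HYPOTHESES; no
item is closed; BSD is not proved by this.

The planner's registered skeleton of 24277 (`KX_birth`, stubs `stub_upper` / `stub_lower`) splits the
crux `Nat.card (Ш(E_K)(2)) = 2^{2M₀}` into the two inequalities over `K`. Both halves are being built
for the PAIR over `ℚ` (upper = the adaptive Cassels–Tate telescope, seats g13–g14,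
`card_mul_card_le_two_pow_two_mul_of_injective`; lower = McCallum Prop. 5.2 at `2`, the
`GenusKolyvaginAtTwo` LINE 18 engines with this seat's CM-inert Čebotarev sockets). Seat g15's count
identity (files XV/XVII, `card_primaryComponent_sha_two_baseChange_mul_two_eq_of_heegnerData_of_facts`:
`#Ш(E_K)[2^∞]·2 = n_E·#Ш(E)[2^∞]·#Ш(E^{(d_K)})[2^∞]·2^{Σ}`; prime `|d_K|` on H₂: `#Ш(E_K)[2^∞] = #Ш(E)[2^∞]·#Ш(E^{(d_K)})[2^∞]`,
file IX) transports EACH half separately, in the `≤` currency of the stubs and in the `∣` currency of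
the `GenusKolyvaginAtTwo` items (`ShaCardDvdPow…` / `PowDvdShaCard…`):

* every odd `d_K` (defect form): `card_primaryComponent_sha_two_baseChange_le_pow_of_pairDefect_le_of_facts`,
  `pow_le_card_primaryComponent_sha_two_baseChange_of_le_pairDefect_of_facts`,
  `card_primaryComponent_sha_two_baseChange_dvd_pow_of_pairDefect_dvd_of_facts`,
  `pow_dvd_card_primaryComponent_sha_two_baseChange_of_dvd_pairDefect_of_facts`;
* prime `|d_K|` on H₂ (CM, `CMInert W 2`): `card_primaryComponent_sha_two_baseChange_le_pow_of_pair_le_of_facts`,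
  `pow_le_card_primaryComponent_sha_two_baseChange_of_le_pair_of_facts`,
  `card_primaryComponent_sha_two_baseChange_dvd_pow_of_pair_dvd_of_facts`,
  `pow_dvd_card_primaryComponent_sha_two_baseChange_of_dvd_pair_of_facts`.

So `stub_upper` ⟸ facts ∧ «`#Ш(E)[2^∞]·#Ш(E^{(d_K)})[2^∞] ≤ 2^{2M₀}`» and `stub_lower` ⟸ facts ∧
«`2^{2M₀} ≤ #Ш(E)[2^∞]·#Ш(E^{(d_K)})[2^∞]`» on prime `|d_K|`; for composite odd `d_K` the pair bounds
carry the genus defect `2^{Σ−1}` (`Σ ≥ 1` on `Δ < 0`, file XVI).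
References: [Milne1972ArithmeticAV] §1 Thm. 1; [Kramer1981] Prop. 3; [McCallumLMS1991] §5 Thm. 5.4, Cor. 5.6.
-/

-- single-conjunct summit: `Summit.BirchSwinnertonDyer.BirchSwinnertonDyer.…` repeats the name by design
set_option linter.dupNamespace false
set_option autoImplicit false

noncomputable section

open scoped Classical

open WeierstrassCurve NumberField Literature.NumberTheory.EllipticCurves
  Literature.NumberTheory.EllipticCurves.ModularForms Literature.NumberTheory.EllipticCurves.Rank1Residual
  Literature.NumberTheory.QuadraticFields

namespace Summit.BirchSwinnertonDyer.BirchSwinnertonDyer.Theorems.ShaCountTwo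

/-! ## Every odd `d_K`: the halves with the genus defect -/

section Defect

variable (hGZ : ∀ (N : ℕ) [NeZero N] (W : WeierstrassCurve ℚ) (K : Type) [Field K] [NumberField K],
    gross_zagier N W K)
  (hGZK : rank_eq_analyticRank_of_analyticRank_le_one) (hmod : hasEntireLFunction_rat)
  (hMilneC : Milne1972.bsdQuotient_baseChange_quadratic_anyModel)
  (W : WeierstrassCurve ℚ) [W.IsElliptic] [W.IsGloballyMinimal] [NeZero (W.conductorNorm ℤ)]
  (hsurj : W.HasSurjectiveModNGaloisRep 2)
  (K : Type) [Field K] [NumberField K] (hK : IsImaginaryQuadratic K)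
  (hodd : Odd (NumberField.discr K)) (hH : SatisfiesHeegnerHypothesis (W.conductorNorm ℤ) K)
  (Dt : ModularParametrizationData W (W.conductorNorm ℤ)) (β : ℤ) (ι : K →+* ℂ)
  (d₁ : KolyvaginHeegnerData Dt β ι 1) (hy : ¬ IsOfFinAddOrder d₁.derivedPoint)

include hGZ hGZK hmod hMilneC hsurj hK hodd hH hy

/-- **UPPER HALF over `K` from the upper half for the pair with defect.** Under the hypotheses of
`card_primaryComponent_sha_two_baseChange_mul_two_eq_of_heegnerData_of_facts`: if
`n_E · #Ш(E)[2^∞] · #Ш(E^{(d_K)})[2^∞] · 2^{Σ} ≤ 2^{2M₀+1}` then `#Ш(E_K)[2^∞] ≤ 2^{2M₀}` (the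
conclusion of the registered `stub_upper`). [cite: McCallumLMS1991, §1 Theorem, §5 Thm. 5.4 "≤"]
[cite: Milne1972ArithmeticAV, §1 Thm. 1] [cite: Kramer1981, Prop. 3] -/
theorem card_primaryComponent_sha_two_baseChange_le_pow_of_pairDefect_le_of_facts {M₀ : ℕ}
    (hpair : (if 0 < W.Δ then 2 else 1) *
      (Nat.card (AddCommGroup.primaryComponent W.sha 2) *
        Nat.card (AddCommGroup.primaryComponent (W.quadraticTwist (NumberField.discr K : ℚ)).sha 2)) *
      2 ^ ∑ q ∈ (NumberField.discr K).natAbs.primeFactors,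
        ((if jacobiSym W.Δ.num q = -1 then 1 else 0) +
          (if jacobiSym W.Δ.num q = 1 ∧ Even (W.frobeniusTrace q) then 2 else 0)) ≤
      2 ^ (2 * M₀ + 1)) :
    Nat.card (AddCommGroup.primaryComponent (W.baseChange K).sha 2) ≤ 2 ^ (2 * M₀) := by
  have h := (card_primaryComponent_sha_two_baseChange_mul_two_eq_of_heegnerData_of_facts hGZ hGZK hmod
    hMilneC W hsurj K hK hodd hH Dt β ι d₁ hy).2
  rw [← h, pow_succ] at hpair
  exact Nat.le_of_mul_le_mul_right hpair two_pos

/-- **LOWER HALF over `K` from the lower half for the pair with defect**: if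
`2^{2M₀+1} ≤ n_E · #Ш(E)[2^∞] · #Ш(E^{(d_K)})[2^∞] · 2^{Σ}` then `2^{2M₀} ≤ #Ш(E_K)[2^∞]` (the
conclusion of the registered `stub_lower`). [cite: McCallumLMS1991, §5 Prop. 5.2, Thm. 5.4 "≥"]
[cite: Milne1972ArithmeticAV, §1 Thm. 1] [cite: Kramer1981, Prop. 3] -/
theorem pow_le_card_primaryComponent_sha_two_baseChange_of_le_pairDefect_of_facts {M₀ : ℕ}
    (hpair : 2 ^ (2 * M₀ + 1) ≤ (if 0 < W.Δ then 2 else 1) *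
      (Nat.card (AddCommGroup.primaryComponent W.sha 2) *
        Nat.card (AddCommGroup.primaryComponent (W.quadraticTwist (NumberField.discr K : ℚ)).sha 2)) *
      2 ^ ∑ q ∈ (NumberField.discr K).natAbs.primeFactors,
        ((if jacobiSym W.Δ.num q = -1 then 1 else 0) +
          (if jacobiSym W.Δ.num q = 1 ∧ Even (W.frobeniusTrace q) then 2 else 0))) :
    2 ^ (2 * M₀) ≤ Nat.card (AddCommGroup.primaryComponent (W.baseChange K).sha 2) := by
  have h := (card_primaryComponent_sha_two_baseChange_mul_two_eq_of_heegnerData_of_facts hGZ hGZK hmod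
    hMilneC W hsurj K hK hodd hH Dt β ι d₁ hy).2
  rw [← h, pow_succ] at hpair
  exact Nat.le_of_mul_le_mul_right hpair two_pos

/-- Divisibility currency (the `GenusKolyvaginAtTwo` items `ShaCardDvdPow…`): if
`n_E · #Ш(E)[2^∞] · #Ш(E^{(d_K)})[2^∞] · 2^{Σ} ∣ 2^{2M₀+1}` then `#Ш(E_K)[2^∞] ∣ 2^{2M₀}`.
[cite: McCallumLMS1991, §1 Theorem] [cite: Milne1972ArithmeticAV, §1 Thm. 1] [cite: Kramer1981, Prop. 3] -/
theorem card_primaryComponent_sha_two_baseChange_dvd_pow_of_pairDefect_dvd_of_facts {M₀ : ℕ}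
    (hpair : (if 0 < W.Δ then 2 else 1) *
      (Nat.card (AddCommGroup.primaryComponent W.sha 2) *
        Nat.card (AddCommGroup.primaryComponent (W.quadraticTwist (NumberField.discr K : ℚ)).sha 2)) *
      2 ^ ∑ q ∈ (NumberField.discr K).natAbs.primeFactors,
        ((if jacobiSym W.Δ.num q = -1 then 1 else 0) +
          (if jacobiSym W.Δ.num q = 1 ∧ Even (W.frobeniusTrace q) then 2 else 0)) ∣
      2 ^ (2 * M₀ + 1)) :
    Nat.card (AddCommGroup.primaryComponent (W.baseChange K).sha 2) ∣ 2 ^ (2 * M₀) := by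
  have h := (card_primaryComponent_sha_two_baseChange_mul_two_eq_of_heegnerData_of_facts hGZ hGZK hmod
    hMilneC W hsurj K hK hodd hH Dt β ι d₁ hy).2
  rw [← h, pow_succ] at hpair
  exact Nat.dvd_of_mul_dvd_mul_right two_pos hpair

/-- Divisibility currency (the `GenusKolyvaginAtTwo` items `PowDvdShaCard…`): if
`2^{2M₀+1} ∣ n_E · #Ш(E)[2^∞] · #Ш(E^{(d_K)})[2^∞] · 2^{Σ}` then `2^{2M₀} ∣ #Ш(E_K)[2^∞]`.
[cite: McCallumLMS1991, §5 Prop. 5.2, Thm. 5.4] [cite: Milne1972ArithmeticAV, §1 Thm. 1] [cite: Kramer1981, Prop. 3] -/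
theorem pow_dvd_card_primaryComponent_sha_two_baseChange_of_dvd_pairDefect_of_facts {M₀ : ℕ}
    (hpair : 2 ^ (2 * M₀ + 1) ∣ (if 0 < W.Δ then 2 else 1) *
      (Nat.card (AddCommGroup.primaryComponent W.sha 2) *
        Nat.card (AddCommGroup.primaryComponent (W.quadraticTwist (NumberField.discr K : ℚ)).sha 2)) *
      2 ^ ∑ q ∈ (NumberField.discr K).natAbs.primeFactors,
        ((if jacobiSym W.Δ.num q = -1 then 1 else 0) +
          (if jacobiSym W.Δ.num q = 1 ∧ Even (W.frobeniusTrace q) then 2 else 0))) :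
    2 ^ (2 * M₀) ∣ Nat.card (AddCommGroup.primaryComponent (W.baseChange K).sha 2) := by
  have h := (card_primaryComponent_sha_two_baseChange_mul_two_eq_of_heegnerData_of_facts hGZ hGZK hmod
    hMilneC W hsurj K hK hodd hH Dt β ι d₁ hy).2
  rw [← h, pow_succ] at hpair
  exact Nat.dvd_of_mul_dvd_mul_right two_pos hpair

end Defect

/-! ## Prime `|d_K|` on H₂: the halves for the plain pair -/

section Prime

variable (hGZ : ∀ (N : ℕ) [NeZero N] (W : WeierstrassCurve ℚ) (K : Type) [Field K] [NumberField K],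
    gross_zagier N W K)
  (hGZK : rank_eq_analyticRank_of_analyticRank_le_one) (hmod : hasEntireLFunction_rat)
  (hMilneC : Milne1972.bsdQuotient_baseChange_quadratic_anyModel)
  (W : WeierstrassCurve ℚ) [W.IsElliptic] [W.IsGloballyMinimal] [NeZero (W.conductorNorm ℤ)]
  (hCM : W.HasCM) (hin : CMInert W 2) (hsurj : W.HasSurjectiveModNGaloisRep 2)
  (K : Type) [Field K] [NumberField K] (hK : IsImaginaryQuadratic K)
  (hodd : Odd (NumberField.discr K)) (hH : SatisfiesHeegnerHypothesis (W.conductorNorm ℤ) K)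
  (hq : (NumberField.discr K).natAbs.Prime)
  (Dt : ModularParametrizationData W (W.conductorNorm ℤ)) (β : ℤ) (ι : K →+* ℂ)
  (d₁ : KolyvaginHeegnerData Dt β ι 1) (hy : ¬ IsOfFinAddOrder d₁.derivedPoint)

include hGZ hGZK hmod hMilneC hCM hin hsurj hK hodd hH hq hy

/-- **UPPER HALF over `K` ⟸ UPPER HALF for the pair, prime `|d_K|` on H₂** (`W` with CM, `CMInert W 2`,
`ρ̄_{W,2}` onto; `K` a prime Heegner field; Heegner datum with `y_K` of infinite order; modulo GZ /
GZK / modularity / Milne): `#Ш(E)[2^∞] · #Ш(E^{(d_K)})[2^∞] ≤ 2^{2M₀} ⟹ #Ш(E_K)[2^∞] ≤ 2^{2M₀}`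
(the registered `stub_upper`'s conclusion). [cite: McCallumLMS1991, §1 Theorem, §5 Thm. 5.4 "≤"]
[cite: Milne1972ArithmeticAV, §1 Thm. 1] -/
theorem card_primaryComponent_sha_two_baseChange_le_pow_of_pair_le_of_facts {M₀ : ℕ}
    (hpair : Nat.card (AddCommGroup.primaryComponent W.sha 2) *
      Nat.card (AddCommGroup.primaryComponent (W.quadraticTwist (NumberField.discr K : ℚ)).sha 2) ≤
        2 ^ (2 * M₀)) :
    Nat.card (AddCommGroup.primaryComponent (W.baseChange K).sha 2) ≤ 2 ^ (2 * M₀) := by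
  rw [(card_primaryComponent_sha_two_baseChange_eq_mul_of_heegnerData_of_facts hGZ hGZK hmod hMilneC W hCM
    hin hsurj K hK hodd hH hq Dt β ι d₁ hy).2]
  exact hpair

/-- **LOWER HALF over `K` ⟸ LOWER HALF for the pair, prime `|d_K|` on H₂**:
`2^{2M₀} ≤ #Ш(E)[2^∞] · #Ш(E^{(d_K)})[2^∞] ⟹ 2^{2M₀} ≤ #Ш(E_K)[2^∞]` (the registered `stub_lower`'s
conclusion). [cite: McCallumLMS1991, §5 Prop. 5.2, Thm. 5.4 "≥"] [cite: Milne1972ArithmeticAV, §1 Thm. 1] -/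
theorem pow_le_card_primaryComponent_sha_two_baseChange_of_le_pair_of_facts {M₀ : ℕ}
    (hpair : 2 ^ (2 * M₀) ≤ Nat.card (AddCommGroup.primaryComponent W.sha 2) *
      Nat.card (AddCommGroup.primaryComponent (W.quadraticTwist (NumberField.discr K : ℚ)).sha 2)) :
    2 ^ (2 * M₀) ≤ Nat.card (AddCommGroup.primaryComponent (W.baseChange K).sha 2) := by
  rw [(card_primaryComponent_sha_two_baseChange_eq_mul_of_heegnerData_of_facts hGZ hGZK hmod hMilneC W hCM
    hin hsurj K hK hodd hH hq Dt β ι d₁ hy).2]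
  exact hpair

/-- Divisibility currency, prime `|d_K|` on H₂: `#Ш(E)[2^∞] · #Ш(E^{(d_K)})[2^∞] ∣ 2^{2M₀} ⟹
#Ш(E_K)[2^∞] ∣ 2^{2M₀}`. [cite: McCallumLMS1991, §1 Theorem] [cite: Milne1972ArithmeticAV, §1 Thm. 1] -/
theorem card_primaryComponent_sha_two_baseChange_dvd_pow_of_pair_dvd_of_facts {M₀ : ℕ}
    (hpair : Nat.card (AddCommGroup.primaryComponent W.sha 2) *
      Nat.card (AddCommGroup.primaryComponent (W.quadraticTwist (NumberField.discr K : ℚ)).sha 2) ∣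
        2 ^ (2 * M₀)) :
    Nat.card (AddCommGroup.primaryComponent (W.baseChange K).sha 2) ∣ 2 ^ (2 * M₀) := by
  rw [(card_primaryComponent_sha_two_baseChange_eq_mul_of_heegnerData_of_facts hGZ hGZK hmod hMilneC W hCM
    hin hsurj K hK hodd hH hq Dt β ι d₁ hy).2]
  exact hpair

/-- Divisibility currency, prime `|d_K|` on H₂: `2^{2M₀} ∣ #Ш(E)[2^∞] · #Ш(E^{(d_K)})[2^∞] ⟹
2^{2M₀} ∣ #Ш(E_K)[2^∞]`. [cite: McCallumLMS1991, §5 Prop. 5.2, Thm. 5.4] [cite: Milne1972ArithmeticAV, §1 Thm. 1] -/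
theorem pow_dvd_card_primaryComponent_sha_two_baseChange_of_dvd_pair_of_facts {M₀ : ℕ}
    (hpair : 2 ^ (2 * M₀) ∣ Nat.card (AddCommGroup.primaryComponent W.sha 2) *
      Nat.card (AddCommGroup.primaryComponent (W.quadraticTwist (NumberField.discr K : ℚ)).sha 2)) :
    2 ^ (2 * M₀) ∣ Nat.card (AddCommGroup.primaryComponent (W.baseChange K).sha 2) := by
  rw [(card_primaryComponent_sha_two_baseChange_eq_mul_of_heegnerData_of_facts hGZ hGZK hmod hMilneC W hCM
    hin hsurj K hK hodd hH hq Dt β ι d₁ hy).2]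
  exact hpair

end Prime

end Summit.BirchSwinnertonDyer.BirchSwinnertonDyer.Theorems.ShaCountTwo

end
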